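import Mathlib
import Literature.AlgebraicGeometry.HyperbolicPolynomials.Garding

/-!
# Root counts in a closed set are upper semicontinuous; the real-root count of a continuous matrix
# family is Borel measurable

Helpers for the support item `PositivityDeficitLeDefects` (stmt-QuantumFields-8970) of route
`SpectralDefectExtinction` (`Summit.QuantumFields.QCD`), whose integrand is the number (with algebraic
multiplicity) of REAL eigenvalues of the massless Wilson–Dirac operator `D_W(U,0,1)` below a threshold,
`Multiset.countP (fun z => z.im = 0 ∧ z.re < c) (charpoly (D_W U)).roots`, integrated against the Wilson
measure.  A Bochner integral of a non-measurable function is the junk value `0`, so measurability of this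
count in the gauge field `U` is a genuine proof obligation.  It is discharged here in three steps:

* `le_countP_roots_of_tendsto` — **upper semicontinuity** (folklore; Pólya 1929 §2 for real roots): if
  `G_N → g ≠ 0` coefficientwise with `deg G_N ≤ deg g`, `F ⊆ ℂ` is closed and every `G_N` has at least `r`
  roots in `F` (counted with multiplicity), then so does `g` (induction on `r`: a bounded sequence of roots
  in `F` has a limit point `a ∈ F`, `g(a) = 0`, and the quotients by the linear factors converge);
* `continuous_charpoly_coeff` — the coefficients of `Matrix.charpoly` are polynomial (Mathlib's universal
  characteristic polynomial `Matrix.charpoly.univ`), hence continuous, in the entries;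
* `isClosed_le_countP_charpoly_roots`, `measurable_countP_charpoly_roots_real_lt` — for a continuous
  matrix family `A : X → Matrix n n ℂ` on a sequential space, `{x | k ≤ #roots of charpoly (A x) in F}` is
  closed for closed `F`, and the count over the half-OPEN real half-line `{Im z = 0, Re z < c}` is Borel
  measurable (its superlevel sets are countable unions of the closed ones for `Re z ≤ c − 1/(j+1)`).
-/

namespace Summit.QuantumFields.QCD.Theorems.PositivityDeficitLeDefects

open Polynomial Filter Topology

/-! ## Upper semicontinuity of the number of roots in a closed set -/

section USC

variable {F : Set ℂ} [DecidablePred (· ∈ F)]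

/-- Roots of `(X − t) · q` in `F`, with multiplicity: those of `q`, plus one if `t ∈ F`. -/
theorem countP_roots_X_sub_C_mul {q : ℂ[X]} (hq : q ≠ 0) (t : ℂ) :
    ((X - C t) * q).roots.countP (· ∈ F) = q.roots.countP (· ∈ F) + if t ∈ F then 1 else 0 := by
  have hne : (X - C t) * q ≠ 0 := mul_ne_zero (X_sub_C_ne_zero t) hq
  rw [roots_mul hne, roots_X_sub_C, Multiset.countP_add, ← Multiset.cons_zero t,
    Multiset.countP_cons, Multiset.countP_zero, zero_add, add_comm]

/-- **Upper semicontinuity of the number of roots in a closed set (with multiplicity).**  If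
`G_N → g ≠ 0` coefficientwise, `deg G_N ≤ deg g = n`, `F` is closed and each `G_N` has at least `r` roots
in `F` counted with multiplicity, then `g` has at least `r` roots in `F` counted with multiplicity.
(Induction on `r`: the chosen roots `t_N ∈ F` are bounded — Cauchy bound, uniformly along the sequence —
so a subsequence converges to some `a ∈ F` with `g(a) = 0`; the quotients `G_N/(X − t_N) → g/(X − a)`
coefficientwise and carry at least `r − 1` roots in `F`.) [folklore] -/
theorem le_countP_roots_of_tendsto (hF : IsClosed F) (r : ℕ) :
    ∀ (n : ℕ) (g : ℂ[X]) (G : ℕ → ℂ[X]), g ≠ 0 → g.natDegree = n →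
      (∀ N, (G N).natDegree ≤ n) →
      (∀ k, Tendsto (fun N => (G N).coeff k) atTop (𝓝 (g.coeff k))) →
      (∀ N, r ≤ (G N).roots.countP (· ∈ F)) → r ≤ g.roots.countP (· ∈ F) := by
  induction r with
  | zero => intros; exact Nat.zero_le _
  | succ r ih =>
    intro n g G hg hn hdeg hcoef hcount
    -- a root of `G N` inside `F`
    have hex : ∀ N, ∃ t, t ∈ (G N).roots ∧ t ∈ F := fun N => by
      obtain ⟨t, ht, htF⟩ :=
        Multiset.countP_pos.1 (Nat.lt_of_lt_of_le (Nat.succ_pos r) (hcount N))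
      exact ⟨t, ht, htF⟩
    choose t ht htF using hex
    have hG0 : ∀ N, G N ≠ 0 := fun N h => by
      have h' := ht N
      rw [h, roots_zero] at h'
      exact Multiset.notMem_zero _ h'
    have htroot : ∀ N, (G N).IsRoot (t N) := fun N => (mem_roots (hG0 N)).1 (ht N)
    -- the leading coefficient of `g`
    have hlc : g.coeff n ≠ 0 := by
      rw [← hn]
      exact fun h => hg (leadingCoeff_eq_zero.1 h)
    -- the roots are eventually bounded, so a subsequence of `t` converges, to a point of `F`
    obtain ⟨R, hR⟩ :=
      Literature.AlgebraicGeometry.HyperbolicPolynomials.eventually_roots_norm_le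
        (l := atTop) hdeg hlc hcoef
    have hfreq : ∃ᶠ N in atTop, t N ∈ Metric.closedBall (0 : ℂ) R :=
      (hR.mono fun N hN => mem_closedBall_zero_iff.2 (hN (t N) (ht N))).frequently
    obtain ⟨a, -, φ, hφ, hta⟩ :=
      tendsto_subseq_of_frequently_bounded Metric.isBounded_closedBall hfreq
    have haF : a ∈ F := hF.mem_of_tendsto hta (Eventually.of_forall fun N => htF (φ N))
    -- `a` is a root of `g`
    have hlim : Tendsto (fun N => (G (φ N)).eval (t (φ N))) atTop (𝓝 (g.eval a)) := by
      have h1 : ∀ N, (G (φ N)).eval (t (φ N)) =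
          ∑ k ∈ Finset.range (n + 1), (G (φ N)).coeff k * (t (φ N)) ^ k := fun N =>
        eval_eq_sum_range' (Nat.lt_succ_of_le (hdeg _)) _
      simp_rw [h1]
      rw [eval_eq_sum_range' (Nat.lt_succ_of_le hn.le) a]
      refine tendsto_finsetSum _ fun k _ => ?_
      exact ((hcoef k).comp hφ.tendsto_atTop).mul (hta.pow k)
    have heval : g.eval a = 0 := by
      have h2 : (fun N => (G (φ N)).eval (t (φ N))) = fun _ => (0 : ℂ) :=
        funext fun N => (htroot _).eq_zero
      rw [h2] at hlim
      exact (tendsto_nhds_unique tendsto_const_nhds hlim).symm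
    -- `n ≥ 1`
    have hn1 : 1 ≤ n := by
      by_contra h
      have h0 : g.natDegree = 0 := by omega
      have hgC := eq_C_of_natDegree_eq_zero h0
      rw [hgC, eval_C] at heval
      exact hg (by rw [hgC, heval, C_0])
    -- divide out the linear factors
    set g₁ : ℂ[X] := g /ₘ (X - C a) with hg₁
    have hgfac : (X - C a) * g₁ = g := mul_divByMonic_eq_iff_isRoot.2 heval
    set G₁ : ℕ → ℂ[X] := fun N => G (φ N) /ₘ (X - C (t (φ N))) with hG₁
    have hGfac : ∀ N, (X - C (t (φ N))) * G₁ N = G (φ N) := fun N =>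
      mul_divByMonic_eq_iff_isRoot.2 (htroot _)
    have hg₁0 : g₁ ≠ 0 := fun h => hg (by rw [← hgfac, h, mul_zero])
    have hG₁0 : ∀ N, G₁ N ≠ 0 := fun N h => hG0 (φ N) (by rw [← hGfac N, h, mul_zero])
    have hg₁deg : g₁.natDegree = n - 1 := by
      rw [hg₁, natDegree_divByMonic _ (monic_X_sub_C a), natDegree_X_sub_C, hn]
    have hG₁deg : ∀ N, (G₁ N).natDegree ≤ n - 1 := fun N => by
      simp only [hG₁]
      rw [natDegree_divByMonic _ (monic_X_sub_C _), natDegree_X_sub_C]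
      exact Nat.sub_le_sub_right (hdeg _) 1
    have hG₁count : ∀ N, r ≤ (G₁ N).roots.countP (· ∈ F) := fun N => by
      have h := hcount (φ N)
      rw [← hGfac N, countP_roots_X_sub_C_mul (hG₁0 N), if_pos (htF (φ N))] at h
      omega
    have hG₁coef : ∀ k, Tendsto (fun N => (G₁ N).coeff k) atTop (𝓝 (g₁.coeff k)) := by
      suffices hsuff : ∀ m k, n ≤ k + m →
          Tendsto (fun N => (G₁ N).coeff k) atTop (𝓝 (g₁.coeff k)) from
        fun k => hsuff n k (by omega)
      intro m
      induction m with
      | zero =>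
        intro k hk
        have h1 : ∀ N, (G₁ N).coeff k = 0 := fun N =>
          coeff_eq_zero_of_natDegree_lt (by have := hG₁deg N; omega)
        have h2 : g₁.coeff k = 0 := coeff_eq_zero_of_natDegree_lt (by omega)
        simp only [h1, h2]
        exact tendsto_const_nhds
      | succ m ihm =>
        intro k hk
        have hrec : ∀ N, (G₁ N).coeff k =
            (G (φ N)).coeff (k + 1) + t (φ N) * (G₁ N).coeff (k + 1) := fun N => by
          have h := congrArg (fun p : ℂ[X] => p.coeff (k + 1)) (hGfac N)
          simp only [coeff_X_sub_C_mul] at h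
          rw [← h]
          ring
        have hrec' : g₁.coeff k = g.coeff (k + 1) + a * g₁.coeff (k + 1) := by
          have h := congrArg (fun p : ℂ[X] => p.coeff (k + 1)) hgfac
          simp only [coeff_X_sub_C_mul] at h
          rw [← h]
          ring
        simp only [hrec]
        rw [hrec']
        exact ((hcoef (k + 1)).comp hφ.tendsto_atTop).add (hta.mul (ihm (k + 1) (by omega)))
    have hih := ih (n - 1) g₁ G₁ hg₁0 hg₁deg hG₁deg hG₁coef hG₁count
    rw [← hgfac, countP_roots_X_sub_C_mul hg₁0, if_pos haF]
    omega

end USC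

/-! ## Continuity of the coefficients of the characteristic polynomial -/

section Charpoly

variable {n : Type*} [Fintype n] [DecidableEq n]

/-- The `i`-th coefficient of `charpoly A` is the evaluation at the entries of `A` of the `i`-th
coefficient of Mathlib's universal characteristic polynomial. -/
theorem charpoly_coeff_eq_eval_univ (A : Matrix n n ℂ) (i : ℕ) :
    A.charpoly.coeff i =
      MvPolynomial.eval (fun ij : n × n => A ij.1 ij.2) ((Matrix.charpoly.univ ℂ n).coeff i) := by
  have h := Matrix.charpoly.univ_coeff_eval₂Hom n (RingHom.id ℂ) (fun ij : n × n => A ij.1 ij.2) i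
  rw [MvPolynomial.coe_eval₂Hom] at h
  rw [show MvPolynomial.eval (fun ij : n × n => A ij.1 ij.2) =
      MvPolynomial.eval₂ (RingHom.id ℂ) (fun ij : n × n => A ij.1 ij.2) from rfl, h]
  congr

/-- **The coefficients of the characteristic polynomial depend continuously on the matrix** (they are
polynomials in the entries). [folklore] -/
theorem continuous_charpoly_coeff (i : ℕ) : Continuous fun A : Matrix n n ℂ => A.charpoly.coeff i := by
  simp_rw [charpoly_coeff_eq_eval_univ]
  exact (MvPolynomial.continuous_eval _).comp (by fun_prop)

end Charpoly

/-! ## Closed superlevel sets and measurability of the real-root count of a continuous matrix family -/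

section Family

variable {X : Type*} [TopologicalSpace X] {n : Type*} [Fintype n] [DecidableEq n]

/-- **Closed superlevel sets.**  For a continuous matrix family `A` on a sequential space and a closed
`F ⊆ ℂ`, the set of parameters at which `charpoly (A x)` has at least `k` roots in `F` (with multiplicity)
is closed (`le_countP_roots_of_tendsto` along convergent sequences; all the characteristic polynomials are
monic of the same degree `card n`). [folklore] -/
theorem isClosed_le_countP_charpoly_roots [SequentialSpace X] {A : X → Matrix n n ℂ} (hA : Continuous A)
    {F : Set ℂ} (hF : IsClosed F) [DecidablePred (· ∈ F)] (k : ℕ) :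
    IsClosed {x | k ≤ (A x).charpoly.roots.countP (· ∈ F)} := by
  refine IsSeqClosed.isClosed fun u x hu hux => ?_
  refine le_countP_roots_of_tendsto hF k (Fintype.card n) (A x).charpoly (fun N => (A (u N)).charpoly)
    (Matrix.charpoly_monic _).ne_zero (Matrix.charpoly_natDegree_eq_dim _)
    (fun N => (Matrix.charpoly_natDegree_eq_dim _).le) (fun i => ?_) hu
  exact ((continuous_charpoly_coeff i).comp hA).continuousAt.tendsto.comp hux

/-- The real half-line count below a strict threshold is reached by closed half-lines: for every matrix
`B` there is `j` with `#{roots : Im = 0, Re < c} ≤ #{roots : Im = 0, Re ≤ c − 1/(j+1)}` (finitely many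
roots). -/
theorem exists_countP_real_lt_le_countP_real_le (B : Matrix n n ℂ) (c : ℝ) :
    ∃ j : ℕ, B.charpoly.roots.countP (fun z => z.im = 0 ∧ z.re < c) ≤
      B.charpoly.roots.countP (fun z => z.im = 0 ∧ z.re ≤ c - 1 / ((j : ℝ) + 1)) := by
  classical
  -- for each root strictly below `c`, a margin
  have hmargin : ∀ z : ℂ, z.re < c → ∃ j : ℕ, 1 / ((j : ℝ) + 1) < c - z.re := fun z hz =>
    exists_nat_one_div_lt (sub_pos.2 hz)
  choose! jz hjz using hmargin
  refine ⟨(B.charpoly.roots.toFinset.filter fun z => z.re < c).sup jz, ?_⟩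
  set J := (B.charpoly.roots.toFinset.filter fun z => z.re < c).sup jz with hJ
  have key : ∀ z ∈ B.charpoly.roots, z.re < c → z.re ≤ c - 1 / ((J : ℝ) + 1) := by
    intro z hzmem hzre
    have hzJ : jz z ≤ J := Finset.le_sup (f := jz)
      (Finset.mem_filter.2 ⟨Multiset.mem_toFinset.2 hzmem, hzre⟩)
    have h1 : 1 / ((J : ℝ) + 1) ≤ 1 / ((jz z : ℝ) + 1) :=
      one_div_le_one_div_of_le (by positivity) (by exact_mod_cast Nat.succ_le_succ hzJ)
    have h2 := hjz z hzre
    linarith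
  rw [Multiset.countP_eq_card_filter, Multiset.countP_eq_card_filter]
  refine Multiset.card_le_card ?_
  rw [Multiset.filter_congr (p := fun z => z.im = 0 ∧ z.re < c)
    (q := fun z => (z.im = 0 ∧ z.re < c) ∧ (z.im = 0 ∧ z.re ≤ c - 1 / ((J : ℝ) + 1))) fun z hz =>
      ⟨fun h => ⟨h, h.1, key z hz h.2⟩, fun h => h.1⟩]
  exact Multiset.monotone_filter_right _ fun z hz => hz.2

omit [TopologicalSpace X] in
/-- A function to `ℕ` all of whose superlevel sets are measurable is measurable. -/
theorem measurable_of_measurableSet_le [MeasurableSpace X] {f : X → ℕ}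
    (hf : ∀ k, MeasurableSet {x | k ≤ f x}) : Measurable f := by
  refine measurable_to_countable' fun k => ?_
  have : f ⁻¹' {k} = {x | k ≤ f x} \ {x | k + 1 ≤ f x} := by
    ext x
    simp only [Set.mem_preimage, Set.mem_singleton_iff, Set.mem_sdiff, Set.mem_setOf_eq]
    omega
  rw [this]
  exact (hf k).diff (hf (k + 1))

/-- **Measurability of the real-root count.**  For a continuous matrix family `A` on a sequential space
with a Borel-compatible σ-algebra, the number (with algebraic multiplicity) of REAL eigenvalues of `A x`
strictly below `c` — `Multiset.countP (fun z => z.im = 0 ∧ z.re < c) (charpoly (A x)).roots` — is a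
measurable function of `x`: its superlevel sets are countable unions over `j` of the closed superlevel
sets of the counts over the closed half-lines `{Im z = 0, Re z ≤ c − 1/(j+1)}`. [folklore] -/
theorem measurable_countP_charpoly_roots_real_lt [SequentialSpace X] [MeasurableSpace X]
    [OpensMeasurableSpace X] {A : X → Matrix n n ℂ} (hA : Continuous A) (c : ℝ) :
    Measurable fun x => (A x).charpoly.roots.countP fun z => z.im = 0 ∧ z.re < c := by
  classical
  refine measurable_of_measurableSet_le fun k => ?_
  have hset : {x | k ≤ (A x).charpoly.roots.countP fun z => z.im = 0 ∧ z.re < c} =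
      ⋃ j : ℕ, {x | k ≤ (A x).charpoly.roots.countP
        fun z => z ∈ {w : ℂ | w.im = 0 ∧ w.re ≤ c - 1 / ((j : ℝ) + 1)}} := by
    ext x
    simp only [Set.mem_setOf_eq, Set.mem_iUnion]
    constructor
    · intro hk
      obtain ⟨j, hj⟩ := exists_countP_real_lt_le_countP_real_le (A x) c
      exact ⟨j, hk.trans hj⟩
    · rintro ⟨j, hj⟩
      refine hj.trans ?_
      rw [Multiset.countP_eq_card_filter, Multiset.countP_eq_card_filter]
      refine Multiset.card_le_card (Multiset.monotone_filter_right _ fun z hz => ⟨hz.1, ?_⟩)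
      have : 0 < 1 / ((j : ℝ) + 1) := by positivity
      linarith [hz.2]
  rw [hset]
  refine MeasurableSet.iUnion fun j => IsClosed.measurableSet ?_
  have hFj : IsClosed {w : ℂ | w.im = 0 ∧ w.re ≤ c - 1 / ((j : ℝ) + 1)} :=
    (isClosed_eq Complex.continuous_im continuous_const).inter
      (isClosed_le Complex.continuous_re continuous_const)
  exact isClosed_le_countP_charpoly_roots hA hFj k

end Family

end Summit.QuantumFields.QCD.Theorems.PositivityDeficitLeDefects
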